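import Literature.Computability.AlgebraicComplexity.DDS21TranscriptDilation
import Literature.Computability.AlgebraicComplexity.DDS21EpsIntegralGraded
import HarnessLib

/-!
# DDS 2021, proof of Thm. 3.2: the Claim-3.8 slice bridge
# (graded value `Y|_{z=0}` of `F(x)` ↔ the `z = 0` slices of the dilated transcript)

Theorem-only seam file (cell `val-lit`, row X2-DDS21, RULING (151)(d); 0 definitions, 0 named
facts) between
* the **graded `x`-frame** of the producers (t21's `DDS2021.GradeZero Y w` on
  `FractionRing (MvPolynomial (Fin n) F)`: "`Y|_{z=0} = w`" for a fraction of nonnegative graded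
  order, `DDS21EpsIntegralGraded.lean`; x5's transcript clause
  `GradeZero (f_j / (tn_j/td_j)) (Nw_j/ew_j)` = Claim 3.8's value `(f_j/t_{k−j,j})|_{z=0}`), and
* the **`z`-frame** of the trace-back transcript (t24's field
  `hw0 : rename succ (ew j) * truncDegreeOf 0 1 (N j * B j) = rename succ (Nw j) * truncDegreeOf 0 1 (E j * A j)`
  of `uabpComputes_of_traceBackTranscript_lin'`, `DDS21TraceBackAssembly.lean`), the two being tied
  by p1's dilation `dilFrac : F(x) → F(z,x)`, the `ldeg`-shifted dilations
  `z^{a_j} A_j = dil(tn_j)`, `z^{b_j} B_j = dil(td_j)` (`a_j = b_j + [j ≥ 1]`) and the LINK LEMMA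
  `g_j · E_j = z^{[j≥1]} · N_j` (`DDS21TranscriptDilation.lean`, `link_of_recursion`).

Source: [DuttaDwivediSaxena2022] full version, proof of Thm. 3.2, Claim 3.8 ("`f_j/t_{k−j,j}|_{z=0}
∈ lim Σ F(ε)·(ΠΣ/ΠΣ)·(Σ∧Σ/Σ∧Σ) ⊆ ARO/ARO`", p0035 L932–941) with Claim 3.4's "`(Φ(f_0)/T̃_{k,0})|_{ε=0}
= Φ(f_0)/t_{k,0} ∈ F(x)[[z]]`" (p0029 L777–779) and the normalisation "`T =: z^v · T̃`" (p0028
L758–763, p0031 L815).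

## Contents

* §0 **the `z`-shifted dilation, complements** to p1's §1 (`dil_m g := ∑_{c ≤ deg g} z^c ·
  rename succ (g_{m+c})`, spelled inline; p1's `dilate_eq_X_pow_mul_dilShift(_of_le_ldeg)`,
  `coeff_dilShift`, `truncDegreeOf_one_dilShift(_ldeg)` are used BY NAME, not restated):
  `dilShift_sum_eq_of_lt` (cutoff independence), `dilShift_zero`, `coeff_dilShift_sum`,
  ★ `finSuccEquiv_dilShift_coeff` (the `z^k`-coefficient of `dil_m g` is `g_{m+k}`),
  `truncDegreeOf_zero_dilShift` ("`dil_m g mod z^N`"), ★ `dilShift_ne_zero_of_le_ldeg`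
  (admissible denominators), `map_dilShift` (base change), `totalDegree_dilShift_le`,
  ★ `dilShift_mul` / `dilShift_mul_of_le_ldeg` (EXACT multiplicativity
  `dil_{m₁+m₂}(g₁ g₂) = dil_{m₁} g₁ · dil_{m₂} g₂`), the length-aware program
  `UABPComputesLen.dilShift` (width `(D+1)·(D+2+S·(m+D+1))+2`, length `L+4`) with its explicit
  `UABPComputes` form, and `UABPComputes(Len).initialForm`.
* §1 `sliceZero_of_cross` (t24 g13's banked `z = 0`-slicing glue, absorbed per RULING (154)(a)),
  the primitive atom ★ `slice_eq_of_gradeZero_frac` (any `y ∈ F(x)` with `GradeZero y (Nw/ew)` and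
  any presentation `dilFrac y · Q₁ = P₁`: `rename succ ew · P₁|₀ = rename succ Nw · Q₁|₀`; RULING
  (155)(b) shape, `…_frac'` with `dilFrac y = P₁/Q₁`), and
  ★ **`slice_eq_of_gradeZero_of_link`** — ONE round: from `GradeZero (f/(tn/td)) (Nw/ew)`,
  `z^a A = dil tn`, `z^b B = dil td`, `a = b + m`, `dilFrac f · E = z^m N` (and `tn, ew ≠ 0`; no
  hypothesis on `td`, `E` is needed)
  conclude t24's slice equation `rename succ ew · (N·B)|_{z=0} = rename succ Nw · (E·A)|_{z=0}`.
  Proof: a presentation `Y = P/Q` of `GradeZero`; push `f·td·Q = P·tn` through `dilFrac`;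
  multiply by `E`, substitute, cancel `z^{m+b}` and `z^{ldeg Q}` (regular elements); reduce mod `z`
  (`truncDegreeOf_one_mul`, p1's `truncDegreeOf_one_dilShift`) to
  `(N B)|₀ · rename succ (in Q) = (E A)|₀ · rename succ ([P]_λ)`; finish with the value equation
  `Nw · in Q = ew · [P]_λ` and cancel `rename succ (in Q) ≠ 0`.
* §2 ★ **`hw0_of_gradeZero`** — the round-indexed form in the binder shape of t24's `hw0`,
  with p1's `link_of_recursion` conclusion and x5's `GradeZero` clause as hypotheses VERBATIM
  (`hw0_of_gradeZero_limToFrac`: the same with E1's `limToFrac` spelled instead of `algebraMap`).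

Honest framing: plumbing toward the x-row `DDS2021_thm_3_2` (OPEN by name); `VP ≠ VNP` is NOT
proved and nothing here bears on it.
-/

noncomputable section

open MvPolynomial
open Literature.RingTheory.MvPolynomial
open scoped BigOperators

namespace Literature.Computability.AlgebraicComplexity

namespace DDS2021

/-! ## §0 Complements on the `z`-shifted dilation `dil_m g` -/

section DilShiftAlgebra

variable {R : Type*} [CommSemiring R] {n : ℕ}

/-- The terms of `dil_m g` beyond the total degree vanish, so any two cutoffs past
`deg g − m` give the same sum. [folklore] -/
private theorem dilShift_sum_range_eq {g : MvPolynomial (Fin n) R} {m N₁ N₂ : ℕ} (h12 : N₁ ≤ N₂)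
    (hN : g.totalDegree < m + N₁) :
    ∑ c ∈ Finset.range N₂, (X 0 : MvPolynomial (Fin (n + 1)) R) ^ c *
        rename Fin.succ (homogeneousComponent (m + c) g) =
      ∑ c ∈ Finset.range N₁, (X 0 : MvPolynomial (Fin (n + 1)) R) ^ c *
        rename Fin.succ (homogeneousComponent (m + c) g) := by
  refine (Finset.sum_subset (Finset.range_mono h12) fun c _ hc => ?_).symm
  rw [Finset.mem_range, not_lt] at hc
  rw [homogeneousComponent_eq_zero _ _ (by omega), map_zero, mul_zero]

/-- **Cutoff independence**: in `dil_m g = ∑_{c} z^c · rename succ (g_{m+c})` the summation range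
`c ≤ deg g` may be replaced by `c < N` for any `N` with `deg g < m + N` (the extra / missing terms
are homogeneous components beyond the total degree) — one uniform cutoff for a whole transcript.
[cite: DuttaDwivediSaxena2022, §3 proof of Thm. 3.2, "`Φ : x_i ↦ z · x_i + α_i`" and "Divide and derive" (full version p0028 L751–763)] -/
theorem dilShift_sum_eq_of_lt (g : MvPolynomial (Fin n) R) (m : ℕ) {N : ℕ}
    (hN : g.totalDegree < m + N) :
    ∑ c ∈ Finset.range N, (X 0 : MvPolynomial (Fin (n + 1)) R) ^ c *
        rename Fin.succ (homogeneousComponent (m + c) g) =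
      ∑ c ∈ Finset.range (g.totalDegree + 1), (X 0 : MvPolynomial (Fin (n + 1)) R) ^ c *
        rename Fin.succ (homogeneousComponent (m + c) g) := by
  rcases le_total N (g.totalDegree + 1) with h | h
  · exact (dilShift_sum_range_eq h hN).symm
  · exact dilShift_sum_range_eq h (by omega)

/-- **`dil_0 g = g(z · x)`**: at `m = 0` the shifted dilation is the plain dilation.
[cite: DuttaDwivediSaxena2022, §3 proof of Thm. 3.2, "`Φ : x_i ↦ z · x_i + α_i`" (full version p0028 L751–757)] -/
theorem dilShift_zero (g : MvPolynomial (Fin n) R) :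
    ∑ c ∈ Finset.range (g.totalDegree + 1), (X 0 : MvPolynomial (Fin (n + 1)) R) ^ c *
        rename Fin.succ (homogeneousComponent (0 + c) g) =
      bind₁ (fun i : Fin n => (X 0 * X i.succ : MvPolynomial (Fin (n + 1)) R)) g := by
  simp_rw [zero_add]
  exact (dilate_eq_sum g).symm

/-- Coefficients of a `z`-graded sum `∑_{c<N} z^c · rename succ (g_{m+c})`: the monomial `x^d`
(`d_0` = the `z`-exponent) has coefficient `coeff (tail d) (g_{m + d_0})` if `d_0 < N`, else `0`.
[cite: DuttaDwivediSaxena2022, §3 proof of Thm. 3.2, Claim 3.7 "`∑_i (…) z^i`" (full version p0034 L904–913)] -/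
theorem coeff_dilShift_sum (g : MvPolynomial (Fin n) R) (m N : ℕ) (d : Fin (n + 1) →₀ ℕ) :
    coeff d (∑ c ∈ Finset.range N, (X 0 : MvPolynomial (Fin (n + 1)) R) ^ c *
        rename Fin.succ (homogeneousComponent (m + c) g)) =
      if d 0 < N then coeff (Finsupp.tail d) (homogeneousComponent (m + d 0) g) else 0 := by
  classical
  rw [coeff_sum]
  simp_rw [coeff_X_pow_mul_rename_succ]
  rw [Finset.sum_ite_eq]
  simp only [Finset.mem_range]

/-- ★ **The `z^k`-coefficient of `dil_m g` is the homogeneous component `g_{m+k}`** (the shifted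
frame dictionary; compare `finSuccEquiv_dilate_coeff` at `m = 0`).
[cite: DuttaDwivediSaxena2022, §3 proof of Thm. 3.2 (full version p0028 L751–763; Claim 3.7, p0034 L904–913)] -/
theorem finSuccEquiv_dilShift_coeff (g : MvPolynomial (Fin n) R) (m k : ℕ) :
    Polynomial.coeff (finSuccEquiv R n
        (∑ c ∈ Finset.range (g.totalDegree + 1), (X 0 : MvPolynomial (Fin (n + 1)) R) ^ c *
          rename Fin.succ (homogeneousComponent (m + c) g))) k =
      homogeneousComponent (m + k) g := by
  classical
  ext u
  rw [finSuccEquiv_coeff_coeff, coeff_dilShift, Finsupp.cons_zero, Finsupp.tail_cons]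

/-- The `z^0`-coefficient of `dil_m g` is `g_m` ("`(T / z^v)|_{z=0}`").
[cite: DuttaDwivediSaxena2022, §3 proof of Thm. 3.2, induction hypothesis (3) (full version p0030 L804–805)] -/
theorem finSuccEquiv_dilShift_coeff_zero (g : MvPolynomial (Fin n) R) (m : ℕ) :
    Polynomial.coeff (finSuccEquiv R n
        (∑ c ∈ Finset.range (g.totalDegree + 1), (X 0 : MvPolynomial (Fin (n + 1)) R) ^ c *
          rename Fin.succ (homogeneousComponent (m + c) g))) 0 =
      homogeneousComponent m g := by
  rw [finSuccEquiv_dilShift_coeff, add_zero]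

/-- **"`dil_m g mod z^N`"** is the cutoff-`N` sum: `truncDegreeOf 0 N (dil_m g) =
∑_{c<N} z^c · rename succ (g_{m+c})`.
[cite: DuttaDwivediSaxena2022, §3 proof of Thm. 3.2, "`R_j = F[z]/⟨z^{d_j}⟩`" (full version p0028 L755; p0030 L800–812)] -/
theorem truncDegreeOf_zero_dilShift (g : MvPolynomial (Fin n) R) (m N : ℕ) :
    truncDegreeOf 0 N
        (∑ c ∈ Finset.range (g.totalDegree + 1), (X 0 : MvPolynomial (Fin (n + 1)) R) ^ c *
          rename Fin.succ (homogeneousComponent (m + c) g)) =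
      ∑ c ∈ Finset.range N, (X 0 : MvPolynomial (Fin (n + 1)) R) ^ c *
        rename Fin.succ (homogeneousComponent (m + c) g) := by
  classical
  ext d
  rw [coeff_truncDegreeOf, coeff_dilShift, coeff_dilShift_sum]

/-- ★ **`dil_m g ≠ 0` for `g ≠ 0` and `m ≤ ldeg g`**: its `z^{ldeg g − m}`-coefficient is the
initial form of `g` (B4a `initialForm_ne_zero`). In particular the shifted dilations of nonzero
divisor representatives are admissible denominators in `F(z,x)`.
[cite: DuttaDwivediSaxena2022, §3 proof of Thm. 3.2, induction hypothesis (3) and "`T̃_{k−j,j}` … is not divisible" (full version p0030 L804–809)] -/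
theorem dilShift_ne_zero_of_le_ldeg {g : MvPolynomial (Fin n) R} (hg : g ≠ 0) {m : ℕ}
    (hm : m ≤ ldeg g) :
    ∑ c ∈ Finset.range (g.totalDegree + 1), (X 0 : MvPolynomial (Fin (n + 1)) R) ^ c *
        rename Fin.succ (homogeneousComponent (m + c) g) ≠ 0 := by
  intro h
  have h1 := congrArg (fun P : MvPolynomial (Fin (n + 1)) R =>
    Polynomial.coeff (finSuccEquiv R n P) (ldeg g - m)) h
  simp only [finSuccEquiv_dilShift_coeff, map_zero, Polynomial.coeff_zero] at h1
  rw [Nat.add_sub_cancel' hm] at h1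
  exact initialForm_ne_zero hg h1

/-- Total degree does not grow under a change of coefficients. [folklore] -/
private theorem totalDegree_map_le'' {S₁ : Type*} [CommSemiring S₁] {σ : Type*} (φ : R →+* S₁)
    (p : MvPolynomial σ R) : (MvPolynomial.map φ p).totalDegree ≤ p.totalDegree :=
  Finset.sup_mono (support_map_subset φ p)

/-- Homogeneous components commute with a change of coefficients. [folklore] -/
private theorem map_homogeneousComponent'' {S₁ : Type*} [CommSemiring S₁] {σ : Type*}
    (φ : R →+* S₁) (k : ℕ) (p : MvPolynomial σ R) :
    MvPolynomial.map φ (homogeneousComponent k p) = homogeneousComponent k (MvPolynomial.map φ p) := by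
  classical
  ext d
  rw [coeff_map, coeff_homogeneousComponent, coeff_homogeneousComponent, coeff_map]
  split_ifs
  · rfl
  · rw [map_zero]

/-- **Base change**: `dil_m` commutes with a change of coefficients `φ : R →+* S`
(`map φ (dil_m g) = dil_m (map φ g)`; the cutoff adjusts by `dilShift_sum_eq_of_lt`).
[cite: DuttaDwivediSaxena2022, §3 proof of Thm. 3.2 (full version p0028 L751–763; objects over `F(ε)` resp. `F`, p0030 L800–805)] -/
theorem map_dilShift {S₁ : Type*} [CommSemiring S₁] (φ : R →+* S₁) (g : MvPolynomial (Fin n) R)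
    (m : ℕ) :
    MvPolynomial.map φ (∑ c ∈ Finset.range (g.totalDegree + 1), (X 0 : MvPolynomial (Fin (n + 1)) R) ^ c *
        rename Fin.succ (homogeneousComponent (m + c) g)) =
      ∑ c ∈ Finset.range ((MvPolynomial.map φ g).totalDegree + 1),
        (X 0 : MvPolynomial (Fin (n + 1)) S₁) ^ c *
          rename Fin.succ (homogeneousComponent (m + c) (MvPolynomial.map φ g)) := by
  rw [map_sum]
  simp_rw [map_mul, map_pow, map_X, map_rename, map_homogeneousComponent'']
  have := totalDegree_map_le'' φ g
  exact dilShift_sum_eq_of_lt _ m (by omega)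

/-- `X i` has total degree at most one (also over the trivial ring). [folklore] -/
private theorem totalDegree_X_le_one' {σ : Type*} (i : σ) :
    (X i : MvPolynomial σ R).totalDegree ≤ 1 := by
  rcases subsingleton_or_nontrivial R with hR | hR
  · have h0 : (X i : MvPolynomial σ R) = 0 := by
      rw [← one_mul (X i), ← C_1, Subsingleton.elim (1 : R) 0, C_0, zero_mul]
    simp [h0]
  · simp [totalDegree_X]

/-- `X i` involves at most one variable (also over the trivial ring). [folklore] -/
private theorem card_vars_X_le_one' {σ : Type*} (i : σ) :
    (X i : MvPolynomial σ R).vars.card ≤ 1 := by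
  classical
  rcases subsingleton_or_nontrivial R with hR | hR
  · have h0 : (X i : MvPolynomial σ R) = 0 := by
      rw [← one_mul (X i), ← C_1, Subsingleton.elim (1 : R) 0, C_0, zero_mul]
    simp [h0]
  · simp [vars_X]

/-- `z^c` has total degree at most `c` (also over the trivial ring). [folklore] -/
private theorem totalDegree_X_pow_le' {σ : Type*} (i : σ) (c : ℕ) :
    ((X i : MvPolynomial σ R) ^ c).totalDegree ≤ c := by
  refine (totalDegree_pow _ _).trans ?_
  have := totalDegree_X_le_one' (R := R) (σ := σ) i
  nlinarith

/-- **Degree bound**: `deg (dil_m g) ≤ 2 · deg g − m` (the term `z^c · rename succ (g_{m+c})` has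
degree `c + (m + c)` and is nonzero only for `m + c ≤ deg g`).
[cite: DuttaDwivediSaxena2022, §3 proof of Thm. 3.2, "syntactic degree … bounded by `D_j`" (full version p0030 L800–803)] -/
theorem totalDegree_dilShift_le (g : MvPolynomial (Fin n) R) (m : ℕ) :
    (∑ c ∈ Finset.range (g.totalDegree + 1), (X 0 : MvPolynomial (Fin (n + 1)) R) ^ c *
        rename Fin.succ (homogeneousComponent (m + c) g)).totalDegree ≤ 2 * g.totalDegree - m := by
  refine (totalDegree_finsetSum _ _).trans (Finset.sup_le fun c _ => ?_)
  by_cases hc : g.totalDegree < m + c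
  · rw [homogeneousComponent_eq_zero _ _ hc, map_zero, mul_zero, totalDegree_zero]
    exact Nat.zero_le _
  · rw [not_lt] at hc
    refine (totalDegree_mul _ _).trans ?_
    have h1 := totalDegree_X_pow_le' (R := R) (σ := Fin (n + 1)) 0 c
    have h2 : (rename Fin.succ (homogeneousComponent (m + c) g) :
        MvPolynomial (Fin (n + 1)) R).totalDegree ≤ m + c :=
      (totalDegree_rename_le _ _).trans (homogeneousComponent_isHomogeneous (m + c) g).totalDegree_le
    omega

/-- Coefficients below `m` vanish when the homogeneous components below `m` do. [folklore] -/
private theorem coeff_eq_zero_of_forall_homogeneousComponent_eq_zero {σ : Type*}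
    {g : MvPolynomial σ R} {m : ℕ} (h : ∀ c < m, homogeneousComponent c g = 0) {d : σ →₀ ℕ}
    (hd : d.degree < m) : coeff d g = 0 := by
  have h1 := congrArg (coeff d) (h _ hd)
  rwa [coeff_homogeneousComponent, if_pos rfl, coeff_zero] at h1

/-- Products: if the components of `g₁` below `m₁` and of `g₂` below `m₂` vanish, those of
`g₁ · g₂` below `m₁ + m₂` vanish (graded valuations add). [folklore] -/
private theorem homogeneousComponent_mul_eq_zero {σ : Type*} {g₁ g₂ : MvPolynomial σ R} {m₁ m₂ : ℕ}
    (h₁ : ∀ c < m₁, homogeneousComponent c g₁ = 0) (h₂ : ∀ c < m₂, homogeneousComponent c g₂ = 0)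
    (c : ℕ) (hc : c < m₁ + m₂) : homogeneousComponent c (g₁ * g₂) = 0 := by
  classical
  ext d
  rw [coeff_homogeneousComponent, coeff_zero]
  split_ifs with hd
  · rw [coeff_mul]
    refine Finset.sum_eq_zero fun p hp => ?_
    rw [Finset.HasAntidiagonal.mem_antidiagonal] at hp
    have hdeg : Finsupp.degree p.1 + Finsupp.degree p.2 = c := by rw [← map_add, hp, hd]
    by_cases ha : Finsupp.degree p.1 < m₁
    · rw [coeff_eq_zero_of_forall_homogeneousComponent_eq_zero h₁ ha, zero_mul]
    · rw [coeff_eq_zero_of_forall_homogeneousComponent_eq_zero h₂ (d := p.2) (by omega), mul_zero]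
  · rfl

/-- ★ **Exact multiplicativity of the shifted dilation**: if the components of `g₁` below `m₁` and
of `g₂` below `m₂` vanish (e.g. `m_i ≤ ldeg g_i`), then
`dil_{m₁+m₂} (g₁ · g₂) = dil_{m₁} g₁ · dil_{m₂} g₂` — as polynomials, in every characteristic
(both sides times `z^{m₁+m₂}` are `(g₁ g₂)(z · x) = g₁(z · x) · g₂(z · x)`, and `z^{m₁+m₂}` is a
regular element). The `z`-frame form of "`ε^{a}·T̃ · ε^{b}·T̃' = ε^{a+b}·(T̃ T̃')`".
[cite: DuttaDwivediSaxena2022, §3 proof of Thm. 3.2, "Divide and derive" normalisations (full version p0028 L758–763; p0031 L824 "`T_{i,j}/T̃_{k−j,j} = ε^{−a}·…`")] -/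
theorem dilShift_mul (g₁ g₂ : MvPolynomial (Fin n) R) {m₁ m₂ : ℕ}
    (h₁ : ∀ c < m₁, homogeneousComponent c g₁ = 0) (h₂ : ∀ c < m₂, homogeneousComponent c g₂ = 0) :
    ∑ c ∈ Finset.range ((g₁ * g₂).totalDegree + 1), (X 0 : MvPolynomial (Fin (n + 1)) R) ^ c *
        rename Fin.succ (homogeneousComponent (m₁ + m₂ + c) (g₁ * g₂)) =
      (∑ c ∈ Finset.range (g₁.totalDegree + 1), (X 0 : MvPolynomial (Fin (n + 1)) R) ^ c *
          rename Fin.succ (homogeneousComponent (m₁ + c) g₁)) *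
        ∑ c ∈ Finset.range (g₂.totalDegree + 1), (X 0 : MvPolynomial (Fin (n + 1)) R) ^ c *
          rename Fin.succ (homogeneousComponent (m₂ + c) g₂) := by
  have hreg := (isRegular_X_pow (R := R) (σ := Fin (n + 1)) (n := 0) (m₁ + m₂)).left
  refine hreg ?_
  show (X 0 : MvPolynomial (Fin (n + 1)) R) ^ (m₁ + m₂) * _ =
    (X 0 : MvPolynomial (Fin (n + 1)) R) ^ (m₁ + m₂) * _
  rw [← dilate_eq_X_pow_mul_dilShift (g₁ * g₂) (homogeneousComponent_mul_eq_zero h₁ h₂), map_mul,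
    dilate_eq_X_pow_mul_dilShift g₁ h₁, dilate_eq_X_pow_mul_dilShift g₂ h₂]
  ring

/-- **Multiplicativity at the lowest degrees** (`m_i ≤ ldeg g_i`).
[cite: DuttaDwivediSaxena2022, §3 proof of Thm. 3.2, "Divide and derive" normalisations (full version p0028 L758–763; p0031 L824)] -/
theorem dilShift_mul_of_le_ldeg (g₁ g₂ : MvPolynomial (Fin n) R) {m₁ m₂ : ℕ}
    (h₁ : m₁ ≤ ldeg g₁) (h₂ : m₂ ≤ ldeg g₂) :
    ∑ c ∈ Finset.range ((g₁ * g₂).totalDegree + 1), (X 0 : MvPolynomial (Fin (n + 1)) R) ^ c *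
        rename Fin.succ (homogeneousComponent (m₁ + m₂ + c) (g₁ * g₂)) =
      (∑ c ∈ Finset.range (g₁.totalDegree + 1), (X 0 : MvPolynomial (Fin (n + 1)) R) ^ c *
          rename Fin.succ (homogeneousComponent (m₁ + c) g₁)) *
        ∑ c ∈ Finset.range (g₂.totalDegree + 1), (X 0 : MvPolynomial (Fin (n + 1)) R) ^ c *
          rename Fin.succ (homogeneousComponent (m₂ + c) g₂) :=
  dilShift_mul g₁ g₂ (fun _ hc => homogeneousComponent_eq_zero_of_lt_ldeg (lt_of_lt_of_le hc h₁))
    (fun _ hc => homogeneousComponent_eq_zero_of_lt_ldeg (lt_of_lt_of_le hc h₂))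

end DilShiftAlgebra

section DilShiftPrograms

variable {F : Type*} [CommSemiring F] {n : ℕ}

/-- ★ **Programs for the shifted dilation** (length-aware, explicit budget): an ABP of width `S`
and length `L` for `g` with `deg g ≤ D` yields an ABP of width `(D+1) · (D + 2 + S · (m + D + 1)) + 2`
and length `L + 4` for `dil_m g = ∑_c z^c · rename succ (g_{m+c})` — label `z^c` (degree `≤ D`, one
variable) in series with the re-indexed homogeneous-component program for `g_{m+c}`
(`m + c ≤ m + D`, width `S · (m + D + 1)`, same length), the `D + 1` branches in parallel (the
pattern of `UABPComputesLen.aeval_phi`; p1's `UABPComputes.dilShift` is the one-parameter `s^7`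
form). [cite: DuttaDwivediSaxena2022, §3 proof of Thm. 3.2, "Divide and derive" + Lemma 2.6 (homogeneous parts of ABPs) (full version p0028 L758–763; p0018 L481–498)] -/
theorem UABPComputesLen.dilShift {S L D : ℕ} {g : MvPolynomial (Fin n) F}
    (hg : UABPComputesLen S L g) (hD : g.totalDegree ≤ D) (m : ℕ) :
    UABPComputesLen ((D + 1) * (D + 2 + S * (m + D + 1)) + 2) (L + 4)
      (∑ c ∈ Finset.range (g.totalDegree + 1), (X 0 : MvPolynomial (Fin (n + 1)) F) ^ c *
        MvPolynomial.rename Fin.succ (MvPolynomial.homogeneousComponent (m + c) g)) := by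
  classical
  rw [← dilShift_sum_eq_of_lt g m (N := D + 1) (by omega),
    Finset.sum_range (fun c => (X 0 : MvPolynomial (Fin (n + 1)) F) ^ c *
      MvPolynomial.rename Fin.succ (MvPolynomial.homogeneousComponent (m + c) g))]
  have hterm : ∀ k : Fin (D + 1), UABPComputesLen (D + 2 + S * (m + D + 1)) (1 + L + 1)
      ((X 0 : MvPolynomial (Fin (n + 1)) F) ^ (k : ℕ) *
        MvPolynomial.rename Fin.succ (MvPolynomial.homogeneousComponent (m + k) g)) := fun k => by
    have hk : m + (k : ℕ) ≤ m + D := by have := k.isLt; omega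
    refine (UABPComputesLen.of_label (S := D + 2) (by omega) _ ?_ ?_).mul
      ((hg.homogeneousComponent hk).rename Fin.succ)
    · exact (Finset.card_le_card (vars_pow _ _)).trans (card_vars_X_le_one' (R := F) _)
    · have := totalDegree_X_pow_le' (R := F) (σ := Fin (n + 1)) 0 (k : ℕ)
      have hk' := k.isLt
      omega
  have h := UABPComputesLen.sum _ hterm
  rw [Fintype.card_fin, show 1 + L + 1 + 2 = L + 4 from by omega] at h
  exact h

/-- **Programs for the shifted dilation**, length-free explicit form (`UABPComputes S g`,
`deg g ≤ D` ⇒ `UABPComputes ((D+1) · (D + 2 + S · (m + D + 1)) + 2) (dil_m g)`; compare p1's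
one-parameter `UABPComputes.dilShift`).
[cite: DuttaDwivediSaxena2022, §3 proof of Thm. 3.2, "Divide and derive" + Lemma 2.6 (full version p0028 L758–763; p0018 L481–498)] -/
theorem UABPComputes.dilShift_of_totalDegree_le {S D : ℕ} {g : MvPolynomial (Fin n) F}
    (hg : UABPComputes S g) (hD : g.totalDegree ≤ D) (m : ℕ) :
    UABPComputes ((D + 1) * (D + 2 + S * (m + D + 1)) + 2)
      (∑ c ∈ Finset.range (g.totalDegree + 1), (X 0 : MvPolynomial (Fin (n + 1)) F) ^ c *
        MvPolynomial.rename Fin.succ (MvPolynomial.homogeneousComponent (m + c) g)) := by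
  obtain ⟨L, hg⟩ := hg.exists_len
  exact (hg.dilShift hD m).uabpComputes

/-- **Programs for the initial form**: `UABPComputes S g`, `deg g ≤ D` ⇒
`UABPComputes (S · (D + 1)) (initialForm g)` (`initialForm g = g_{ldeg g}` and `ldeg g ≤ deg g ≤ D`;
the transcript slices `a_j = in(tn_j)`, `βn_j = in(td_j)`, `βt = in(D₀)` with their programs).
[cite: DuttaDwivediSaxena2022, §3 proof of Thm. 3.2, induction hypothesis (3) + Lemma 2.6 (full version p0030 L804–805; p0018 L481–498)] -/
theorem UABPComputes.initialForm {S D : ℕ} {g : MvPolynomial (Fin n) F} (hg : UABPComputes S g)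
    (hD : g.totalDegree ≤ D) : UABPComputes (S * (D + 1)) (DDS2021.initialForm g) :=
  hg.homogeneousComponent ((ldeg_le_totalDegree g).trans hD)

/-- **Programs for the initial form** (length-aware, same length).
[cite: DuttaDwivediSaxena2022, §3 proof of Thm. 3.2, induction hypothesis (3) + Lemma 2.6 (full version p0030 L804–805; p0018 L481–498)] -/
theorem UABPComputesLen.initialForm {S L D : ℕ} {g : MvPolynomial (Fin n) F}
    (hg : UABPComputesLen S L g) (hD : g.totalDegree ≤ D) :
    UABPComputesLen (S * (D + 1)) L (DDS2021.initialForm g) :=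
  hg.homogeneousComponent ((ldeg_le_totalDegree g).trans hD)

end DilShiftPrograms

/-! ## §1 The Claim-3.8 slice bridge: `GradeZero` ⟹ t24's `hw0` slice equation -/

section SliceBridge

variable {F : Type*} [Field F] {n : ℕ}

/-- Coefficient vanishing below `λ` gives component vanishing below `λ`. [folklore] -/
private theorem homogeneousComponent_eq_zero_of_coeff_vanishing {P : MvPolynomial (Fin n) F} {m : ℕ}
    (hP : ∀ d : Fin n →₀ ℕ, d.degree < m → coeff d P = 0) :
    ∀ c < m, homogeneousComponent c P = 0 := by
  intro c hc
  classical
  ext d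
  rw [coeff_homogeneousComponent, coeff_zero]
  split_ifs with hd
  · exact hP d (by rw [hd]; exact hc)
  · rfl

/-- **Claim 3.8's value as the transcript's `hw0`, from a cross identity** (the `z = 0` slice;
t24 g13's banked glue `HOME/np/t24g13-hw0-glue.sliceZero_of_cross.lean.txt`, absorbed here per
RULING (154)(a)): if `U · Qm = Pm · V` in `F[z, x]` (the quotient identity
`f_j/t_j = (N_j B_j)/(E_j A_j)` times a graded model `Y · Q = P` of the `F(x)`-side value,
denominators cleared: `U = N_j B_j`, `V = E_j A_j`, `Qm, Pm` the `ldeg Q`-shifted dilations of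
`Q, P`), with `Qm|_{z=0} = rename succ (in Q)`, `in Q ≠ 0`, `Pm|_{z=0} = rename succ ([P]_{ldeg Q})`
and the value clause `Nw · in(Q) = [P]_{ldeg Q} · ew` of `GradeZero Y (Nw/ew)`, then
`rename succ ew · U|_{z=0} = rename succ Nw · V|_{z=0}` ("`|_{z=0}`" = `truncDegreeOf 0 1` is
multiplicative, `truncDegreeOf_one_mul`; cancel `rename succ (in Q)`).
[cite: DuttaDwivediSaxena2022, §3 proof of Thm. 3.2, Claim 3.8 (full version p0035 L934–941)] -/
theorem sliceZero_of_cross {U V Pm Qm : MvPolynomial (Fin (n + 1)) F}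
    {pm qi Nw ew : MvPolynomial (Fin n) F} (hcross : U * Qm = Pm * V)
    (hQm : truncDegreeOf 0 1 Qm = rename Fin.succ qi) (hqi : qi ≠ 0)
    (hPm : truncDegreeOf 0 1 Pm = rename Fin.succ pm) (hw : Nw * qi = pm * ew) :
    rename Fin.succ ew * truncDegreeOf 0 1 U = rename Fin.succ Nw * truncDegreeOf 0 1 V := by
  have h1 := congr_arg (truncDegreeOf (0 : Fin (n + 1)) 1) hcross
  rw [truncDegreeOf_one_mul, truncDegreeOf_one_mul, hQm, hPm] at h1
  have hqi' : (rename Fin.succ qi : MvPolynomial (Fin (n + 1)) F) ≠ 0 :=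
    fun h => hqi (rename_injective _ (Fin.succ_injective n) (by rw [h, map_zero]))
  have hw' := congr_arg (rename (Fin.succ : Fin n → Fin (n + 1))) hw
  rw [map_mul, map_mul] at hw'
  refine mul_right_cancel₀ hqi' ?_
  calc rename Fin.succ ew * truncDegreeOf 0 1 U * rename Fin.succ qi
      = rename Fin.succ ew * (rename Fin.succ pm * truncDegreeOf 0 1 V) := by rw [mul_assoc, h1]
    _ = rename Fin.succ Nw * rename Fin.succ qi * truncDegreeOf 0 1 V := by rw [hw']; ring
    _ = rename Fin.succ Nw * truncDegreeOf 0 1 V * rename Fin.succ qi := by ring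

/-- **The primitive atom of the slice bridge** (RULING (155)(b) shape): for ANY `y ∈ F(x)` with
graded value `GradeZero y (Nw/ew)` (`ew ≠ 0`) and any `z`-frame presentation
`dilFrac y · Q₁ = P₁` of its dilation (`P₁, Q₁ ∈ F[z,x]`; no non-vanishing needed), the `z = 0`
slices satisfy `rename succ ew · P₁|_{z=0} = rename succ Nw · Q₁|_{z=0}`. (From a graded model
`y·Q = P`: `dil P · Q₁ = P₁ · dil Q` in `F[z,x]`; cancel `z^{ldeg Q}`; slice with
`sliceZero_of_cross`.)
[cite: DuttaDwivediSaxena2022, §3 proof of Thm. 3.2, Claim 3.8 (full version p0035 L934–941) with Claim 3.4 (p0029 L777–779)] -/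
theorem slice_eq_of_gradeZero_frac {y : FractionRing (MvPolynomial (Fin n) F)}
    {Nw ew : MvPolynomial (Fin n) F} {P₁ Q₁ : MvPolynomial (Fin (n + 1)) F}
    (hgz : GradeZero y (algebraMap _ _ Nw / algebraMap _ _ ew)) (hew : ew ≠ 0)
    (hy : dilFrac F n y * algebraMap _ _ Q₁ = algebraMap _ _ P₁) :
    rename Fin.succ ew * truncDegreeOf 0 1 P₁ = rename Fin.succ Nw * truncDegreeOf 0 1 Q₁ := by
  classical
  have hιinj : Function.Injective
      (algebraMap (MvPolynomial (Fin n) F) (FractionRing (MvPolynomial (Fin n) F))) :=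
    IsFractionRing.injective _ _
  have hι'inj : Function.Injective
      (algebraMap (MvPolynomial (Fin (n + 1)) F) (FractionRing (MvPolynomial (Fin (n + 1)) F))) :=
    IsFractionRing.injective _ _
  have hew' : algebraMap (MvPolynomial (Fin n) F) (FractionRing (MvPolynomial (Fin n) F)) ew ≠ 0 :=
    fun h => hew (hιinj (by rw [h, map_zero]))
  obtain ⟨P, Q, hQ, hY, hP, hw⟩ := hgz
  -- `dil P · Q₁ = P₁ · dil Q` in `F[z,x]`
  have h1 := congrArg (dilFrac F n) hY
  rw [map_mul, dilFrac_algebraMap, dilFrac_algebraMap] at h1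
  have h2 : bind₁ (fun i : Fin n => (X 0 * X i.succ : MvPolynomial (Fin (n + 1)) F)) P * Q₁ =
      P₁ * bind₁ (fun i : Fin n => (X 0 * X i.succ : MvPolynomial (Fin (n + 1)) F)) Q := by
    apply hι'inj
    rw [map_mul, map_mul, ← h1, ← hy]
    ring
  -- cancel `z^{ldeg Q}`
  have hPc : ∀ c < ldeg Q, homogeneousComponent c P = 0 :=
    homogeneousComponent_eq_zero_of_coeff_vanishing hP
  rw [dilate_eq_X_pow_mul_dilShift_of_le_ldeg Q (le_refl (ldeg Q)),
    dilate_eq_X_pow_mul_dilShift P hPc] at h2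
  set SQ := ∑ c ∈ Finset.range (Q.totalDegree + 1), (X 0 : MvPolynomial (Fin (n + 1)) F) ^ c *
    rename Fin.succ (homogeneousComponent (ldeg Q + c) Q) with hSQ
  set SP := ∑ c ∈ Finset.range (P.totalDegree + 1), (X 0 : MvPolynomial (Fin (n + 1)) F) ^ c *
    rename Fin.succ (homogeneousComponent (ldeg Q + c) P) with hSP
  have hcross : P₁ * SQ = SP * Q₁ := by
    refine (isRegular_X_pow (R := F) (σ := Fin (n + 1)) (n := 0) (ldeg Q)).left ?_
    show (X 0 : MvPolynomial (Fin (n + 1)) F) ^ ldeg Q * _ =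
      (X 0 : MvPolynomial (Fin (n + 1)) F) ^ ldeg Q * _
    linear_combination -h2
  -- the value equation and the slice
  have hwpoly : Nw * homogeneousComponent (ldeg Q) Q = homogeneousComponent (ldeg Q) P * ew := by
    apply hιinj
    rw [map_mul, map_mul]
    have h := hw
    rw [initialForm_def', div_mul_eq_mul_div, div_eq_iff hew'] at h
    exact h
  exact sliceZero_of_cross hcross (truncDegreeOf_one_dilShift Q (ldeg Q)) (initialForm_ne_zero hQ)
    (truncDegreeOf_one_dilShift P (ldeg Q)) hwpoly

/-- The atom with the presentation as a quotient: `dilFrac y = P₁/Q₁`, `Q₁ ≠ 0`.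
[cite: DuttaDwivediSaxena2022, §3 proof of Thm. 3.2, Claim 3.8 (full version p0035 L934–941)] -/
theorem slice_eq_of_gradeZero_frac' {y : FractionRing (MvPolynomial (Fin n) F)}
    {Nw ew : MvPolynomial (Fin n) F} {P₁ Q₁ : MvPolynomial (Fin (n + 1)) F}
    (hgz : GradeZero y (algebraMap _ _ Nw / algebraMap _ _ ew)) (hew : ew ≠ 0)
    (hy : dilFrac F n y = algebraMap _ _ P₁ / algebraMap _ _ Q₁) (hQ : Q₁ ≠ 0) :
    rename Fin.succ ew * truncDegreeOf 0 1 P₁ = rename Fin.succ Nw * truncDegreeOf 0 1 Q₁ := by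
  refine slice_eq_of_gradeZero_frac hgz hew ?_
  have hQ' : algebraMap (MvPolynomial (Fin (n + 1)) F) (FractionRing (MvPolynomial (Fin (n + 1)) F))
      Q₁ ≠ 0 := fun h => hQ (IsFractionRing.injective _ _ (by rw [h, map_zero]))
  rw [hy, div_mul_cancel₀ _ hQ']

/-- ★ **The slice bridge, one round** (Claim 3.8's value `(f_j/t_{k−j,j})|_{z=0}` in the two
frames). DATA: the producer's residue `f ∈ F(x)` and divisor representatives `tn ≠ 0`, `td ∈ F[x]`
with the graded value `GradeZero (f / (tn/td)) (Nw/ew)` (`ew ≠ 0`); the `z`-frame objects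
`N, E, A, B ∈ F[z,x]` with `z^a · A = dil(tn)`, `z^b · B = dil(td)`, `a = b + m` and the link
`dilFrac f · E = z^m · N` (p1's `link_of_recursion`, `m = [j ≥ 1]`; its `E ≠ 0` is not needed here). CONCLUSION: t24's
transcript field `hw0`, `rename succ (ew) · (N·B)|_{z=0} = rename succ (Nw) · (E·A)|_{z=0}`
(`·|_{z=0} = truncDegreeOf 0 1`). Proof: present the value as `P/Q` (`Q ≠ 0`, `P` vanishing below
`λ = ldeg Q`, `Nw·in(Q) = ew·[P]_λ`); push `f·td·Q = P·tn` through the field map `dilFrac`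
(`x_i ↦ z x_{i+1}`), multiply by `E` and substitute the hypotheses, cancel `z^{m+b}` and `z^{λ}`
(regular elements of `F[z,x]`); reduce modulo `z` — `(dil_λ Q)|_{z=0} = rename succ (in Q)`,
`(dil_λ P)|_{z=0} = rename succ ([P]_λ)` (p1's `truncDegreeOf_one_dilShift`), "`|_{z=0}`" being
multiplicative — and cancel `rename succ (in Q) ≠ 0` (`sliceZero_of_cross`).
[cite: DuttaDwivediSaxena2022, §3 proof of Thm. 3.2, Claim 3.8 (full version p0035 L932–941) with Claim 3.4 (p0029 L777–779)] -/
theorem slice_eq_of_gradeZero_of_link {fj : FractionRing (MvPolynomial (Fin n) F)}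
    {tn td Nw ew : MvPolynomial (Fin n) F} {N E A B : MvPolynomial (Fin (n + 1)) F} {a b m : ℕ}
    (htn : tn ≠ 0) (hew : ew ≠ 0)
    (hA : (X 0 : MvPolynomial (Fin (n + 1)) F) ^ a * A =
      bind₁ (fun i : Fin n => (X 0 * X i.succ : MvPolynomial (Fin (n + 1)) F)) tn)
    (hB : (X 0 : MvPolynomial (Fin (n + 1)) F) ^ b * B =
      bind₁ (fun i : Fin n => (X 0 * X i.succ : MvPolynomial (Fin (n + 1)) F)) td)
    (hab : a = b + m)
    (hlink : dilFrac F n fj * algebraMap _ _ E =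
      algebraMap _ _ ((X 0 : MvPolynomial (Fin (n + 1)) F) ^ m * N))
    (hgz : GradeZero (fj / (algebraMap _ _ tn / algebraMap _ _ td))
      (algebraMap _ _ Nw / algebraMap _ _ ew)) :
    rename Fin.succ ew * truncDegreeOf 0 1 (N * B) =
      rename Fin.succ Nw * truncDegreeOf 0 1 (E * A) := by
  classical
  have hιinj : Function.Injective
      (algebraMap (MvPolynomial (Fin n) F) (FractionRing (MvPolynomial (Fin n) F))) :=
    IsFractionRing.injective _ _
  have hι'inj : Function.Injective
      (algebraMap (MvPolynomial (Fin (n + 1)) F) (FractionRing (MvPolynomial (Fin (n + 1)) F))) :=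
    IsFractionRing.injective _ _
  have htn' : algebraMap (MvPolynomial (Fin n) F) (FractionRing (MvPolynomial (Fin n) F)) tn ≠ 0 :=
    fun h => htn (hιinj (by rw [h, map_zero]))
  have hew' : algebraMap (MvPolynomial (Fin n) F) (FractionRing (MvPolynomial (Fin n) F)) ew ≠ 0 :=
    fun h => hew (hιinj (by rw [h, map_zero]))
  -- Step 1: a presentation of the graded value
  obtain ⟨P, Q, hQ, hY, hP, hw⟩ := hgz
  -- Step 2: `fj · td · Q = P · tn` in `F(x)`
  have h2 : fj * algebraMap _ _ td * algebraMap _ _ Q =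
      algebraMap _ (FractionRing (MvPolynomial (Fin n) F)) P * algebraMap _ _ tn := by
    have h := hY
    rw [div_div_eq_mul_div, div_mul_eq_mul_div, div_eq_iff htn'] at h
    linear_combination h
  -- Step 3: push through `dilFrac` and substitute the `z`-frame objects
  have h3 := congrArg (dilFrac F n) h2
  simp only [map_mul, dilFrac_algebraMap] at h3
  rw [← hA, ← hB] at h3
  -- `h3 : dilFrac fj * ι' (z^b B) * ι' (dil Q) = ι' (dil P) * ι' (z^a A)`
  have h4 : algebraMap _ (FractionRing (MvPolynomial (Fin (n + 1)) F))
          ((X 0 : MvPolynomial (Fin (n + 1)) F) ^ m * N) *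
        algebraMap _ _ ((X 0 : MvPolynomial (Fin (n + 1)) F) ^ b * B) *
        algebraMap _ _ (bind₁ (fun i : Fin n => (X 0 * X i.succ : MvPolynomial (Fin (n + 1)) F)) Q) =
      algebraMap _ _ (bind₁ (fun i : Fin n => (X 0 * X i.succ : MvPolynomial (Fin (n + 1)) F)) P) *
        algebraMap _ _ ((X 0 : MvPolynomial (Fin (n + 1)) F) ^ a * A) * algebraMap _ _ E := by
    rw [← hlink]
    linear_combination (algebraMap _ (FractionRing (MvPolynomial (Fin (n + 1)) F)) E) * h3
  have h5 : (X 0 : MvPolynomial (Fin (n + 1)) F) ^ m * N *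
        ((X 0 : MvPolynomial (Fin (n + 1)) F) ^ b * B) *
        bind₁ (fun i : Fin n => (X 0 * X i.succ : MvPolynomial (Fin (n + 1)) F)) Q =
      bind₁ (fun i : Fin n => (X 0 * X i.succ : MvPolynomial (Fin (n + 1)) F)) P *
        ((X 0 : MvPolynomial (Fin (n + 1)) F) ^ a * A) * E :=
    hι'inj (by simpa only [map_mul] using h4)
  -- Step 4: cancel `z^{m+b}`
  rw [hab] at h5
  have h6 : N * B * bind₁ (fun i : Fin n => (X 0 * X i.succ : MvPolynomial (Fin (n + 1)) F)) Q =
      bind₁ (fun i : Fin n => (X 0 * X i.succ : MvPolynomial (Fin (n + 1)) F)) P * A * E := by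
    refine (isRegular_X_pow (R := F) (σ := Fin (n + 1)) (n := 0) (m + b)).left ?_
    show (X 0 : MvPolynomial (Fin (n + 1)) F) ^ (m + b) * _ =
      (X 0 : MvPolynomial (Fin (n + 1)) F) ^ (m + b) * _
    linear_combination h5
  -- Step 5: expose `z^{ldeg Q}` in `dil Q` and `dil P` and cancel it
  have hPc : ∀ c < ldeg Q, homogeneousComponent c P = 0 :=
    homogeneousComponent_eq_zero_of_coeff_vanishing hP
  rw [dilate_eq_X_pow_mul_dilShift_of_le_ldeg Q (le_refl (ldeg Q)),
    dilate_eq_X_pow_mul_dilShift P hPc] at h6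
  set SQ := ∑ c ∈ Finset.range (Q.totalDegree + 1), (X 0 : MvPolynomial (Fin (n + 1)) F) ^ c *
    rename Fin.succ (homogeneousComponent (ldeg Q + c) Q) with hSQ
  set SP := ∑ c ∈ Finset.range (P.totalDegree + 1), (X 0 : MvPolynomial (Fin (n + 1)) F) ^ c *
    rename Fin.succ (homogeneousComponent (ldeg Q + c) P) with hSP
  have h7 : N * B * SQ = A * E * SP := by
    refine (isRegular_X_pow (R := F) (σ := Fin (n + 1)) (n := 0) (ldeg Q)).left ?_
    show (X 0 : MvPolynomial (Fin (n + 1)) F) ^ ldeg Q * _ =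
      (X 0 : MvPolynomial (Fin (n + 1)) F) ^ ldeg Q * _
    linear_combination h6
  -- Step 6: the value equation `Nw · in Q = [P]_λ · ew` as a polynomial identity
  have hwpoly : Nw * homogeneousComponent (ldeg Q) Q = homogeneousComponent (ldeg Q) P * ew := by
    apply hιinj
    rw [map_mul, map_mul]
    have h := hw
    rw [initialForm_def', div_mul_eq_mul_div, div_eq_iff hew'] at h
    exact h
  -- Step 7: slice at `z = 0` (t24's glue)
  have hcross : N * B * SQ = SP * (E * A) := by rw [h7]; ring
  exact sliceZero_of_cross hcross (truncDegreeOf_one_dilShift Q (ldeg Q)) (initialForm_ne_zero hQ)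
    (truncDegreeOf_one_dilShift P (ldeg Q)) hwpoly

end SliceBridge

/-! ## §2 The round-indexed form: x5's `GradeZero` clause + p1's link ⟹ t24's `hw0` -/

section Rounds

variable {F : Type*} [Field F] {n : ℕ}

/-- ★ **`hw0` of the trace-back transcript from the producers' graded values.** For a DiDIL
transcript with residues `f_j ∈ F(x)`, divisor representatives `tn_j, td_j ≠ 0` of graded
valuation `a_j = b_j + [j ≥ 1]`, `z`-frame objects `z^{a_j} A_j = dil tn_j`, `z^{b_j} B_j = dil td_j`,
the chain `g_j = dilFrac f_j`, p1's link `E_j ≠ 0 ∧ g_j · E_j = z^{[j≥1]} N_j` (conclusion of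
`link_of_recursion`, VERBATIM), and the Claim-3.8 values `GradeZero (f_j/(tn_j/td_j)) (Nw_j/ew_j)`
(`tn_j, ew_j ≠ 0`), every round satisfies t24's field
`hw0 : rename succ (ew j) * truncDegreeOf 0 1 (N j * B j) = rename succ (Nw j) * truncDegreeOf 0 1 (E j * A j)`.
[cite: DuttaDwivediSaxena2022, §3 proof of Thm. 3.2, Claim 3.8 (full version p0035 L932–941); induction hypotheses (1)–(3) (p0030 L799–805)] -/
theorem hw0_of_gradeZero {r : ℕ} (f : ℕ → FractionRing (MvPolynomial (Fin n) F))
    (tn td Nw ew : ℕ → MvPolynomial (Fin n) F) (a b : ℕ → ℕ)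
    (A B N E : ℕ → MvPolynomial (Fin (n + 1)) F)
    (g : ℕ → FractionRing (MvPolynomial (Fin (n + 1)) F))
    (htn : ∀ j < r, tn j ≠ 0) (hew : ∀ j < r, ew j ≠ 0)
    (hA : ∀ j < r, (X 0 : MvPolynomial (Fin (n + 1)) F) ^ a j * A j =
      bind₁ (fun i : Fin n => (X 0 * X i.succ : MvPolynomial (Fin (n + 1)) F)) (tn j))
    (hB : ∀ j < r, (X 0 : MvPolynomial (Fin (n + 1)) F) ^ b j * B j =
      bind₁ (fun i : Fin n => (X 0 * X i.succ : MvPolynomial (Fin (n + 1)) F)) (td j))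
    (hab : ∀ j < r, a j = b j + min j 1)
    (hg : ∀ j < r, g j = dilFrac F n (f j))
    (hlink : ∀ j ≤ r, E j ≠ 0 ∧
      g j * algebraMap _ _ (E j) = algebraMap _ _ ((X 0 : MvPolynomial (Fin (n + 1)) F) ^ min j 1 * N j))
    (hgz : ∀ j < r, GradeZero (f j / (algebraMap _ _ (tn j) / algebraMap _ _ (td j)))
      (algebraMap _ _ (Nw j) / algebraMap _ _ (ew j))) :
    ∀ j < r, rename Fin.succ (ew j) * truncDegreeOf 0 1 (N j * B j) =
      rename Fin.succ (Nw j) * truncDegreeOf 0 1 (E j * A j) := by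
  intro j hj
  obtain ⟨-, hlj⟩ := hlink j hj.le
  rw [hg j hj] at hlj
  exact slice_eq_of_gradeZero_of_link (htn j hj) (hew j hj) (hA j hj) (hB j hj) (hab j hj) hlj
    (hgz j hj)

/-- The same with the producers' embedding `limToFrac F (Fin n) = algebraMap F[x] F(x)` of
`DDS21EpsIntegralFractions.lean` spelled out (x5's (D2) clause verbatim; `limToFrac_apply` is `rfl`).
[cite: DuttaDwivediSaxena2022, §3 proof of Thm. 3.2, Claim 3.8 (full version p0035 L932–941)] -/
theorem hw0_of_gradeZero_limToFrac {r : ℕ} (f : ℕ → FractionRing (MvPolynomial (Fin n) F))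
    (tn td Nw ew : ℕ → MvPolynomial (Fin n) F) (a b : ℕ → ℕ)
    (A B N E : ℕ → MvPolynomial (Fin (n + 1)) F)
    (g : ℕ → FractionRing (MvPolynomial (Fin (n + 1)) F))
    (htn : ∀ j < r, tn j ≠ 0) (hew : ∀ j < r, ew j ≠ 0)
    (hA : ∀ j < r, (X 0 : MvPolynomial (Fin (n + 1)) F) ^ a j * A j =
      bind₁ (fun i : Fin n => (X 0 * X i.succ : MvPolynomial (Fin (n + 1)) F)) (tn j))
    (hB : ∀ j < r, (X 0 : MvPolynomial (Fin (n + 1)) F) ^ b j * B j =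
      bind₁ (fun i : Fin n => (X 0 * X i.succ : MvPolynomial (Fin (n + 1)) F)) (td j))
    (hab : ∀ j < r, a j = b j + min j 1)
    (hg : ∀ j < r, g j = dilFrac F n (f j))
    (hlink : ∀ j ≤ r, E j ≠ 0 ∧
      g j * algebraMap _ _ (E j) = algebraMap _ _ ((X 0 : MvPolynomial (Fin (n + 1)) F) ^ min j 1 * N j))
    (hgz : ∀ j < r, GradeZero (f j / (limToFrac F (Fin n) (tn j) / limToFrac F (Fin n) (td j)))
      (limToFrac F (Fin n) (Nw j) / limToFrac F (Fin n) (ew j))) :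
    ∀ j < r, rename Fin.succ (ew j) * truncDegreeOf 0 1 (N j * B j) =
      rename Fin.succ (Nw j) * truncDegreeOf 0 1 (E j * A j) :=
  hw0_of_gradeZero f tn td Nw ew a b A B N E g htn hew hA hB hab hg hlink hgz

end Rounds

end DDS2021

end Literature.Computability.AlgebraicComplexity

end
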